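import Summits.NavierStokesRegularity.NavierStokesRegularity.Theorems.TerminalTraceTypeITraceScarL3LayerDecay
import Literature.Analysis.FluidPDE.BarkerPrangeConcentrationHolds
import Literature.Analysis.FluidPDE.ClassicalContinuationAPriori

set_option linter.dupNamespace false

/-!
# The ABSOLUTE `L³` floor in the similarity parabola at a Type-I singular point, for the ITEM's binders
# (Barker–Prange 2020 Thm 2 ∘ Leray continuation ∘ Type-I Morrey; nsreg-p2 ROUND-33 seed s33-4)

Barker–Prange, Arch. Ration. Mech. Anal. 236 (2020), Thm. 2, is in the tree and PROVED for GLOBAL Leray–Hopf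
solutions (`BarkerPrange2020_thm2_holds`): there is a universal `γ > 0` such that, for every `M`, some
`S = S(M) ∈ (0, 1/4]` makes the following true — if a global Leray–Hopf solution with viscosity `ν` has the
Morrey-type bound `‖u(t)‖_{L²(B(y,r))} ≤ M ν √r` on the backward cylinders of radius `r < r₀` below `T`, is
regular at every point of `(0,T) × ℝ³`, and is singular at `(T,x₀)`, then for every `t` in a final interval
`‖u(t)‖_{L³(B̄(x₀, 2√(ν(T−t)/S)))} > γν`.

Item `TerminalTrace.TypeITraceScarL3` (stmt-NavierStokesRegularity-18385) quantifies over a Leray–Hopf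
solution on `[0,T]` only.  This file makes the floor CONSUMABLE by the item's binders
(`typeI_singular_L3ParabolicFloor`): Leray's continuation past `T`
(`IsLerayHopfOn.exists_isGlobalLerayHopf_extension_le`: a global Leray–Hopf `w` with `w = u` on `t ≤ T`),
the Type-I Morrey bound (`morrey_of_typeI`, every centre, hence `‖u(t)‖_{L²(B(y,r))} ≤ (√M₀/ν)·ν·√r` for
`T − r²/ν < t < T`, `r` small), regularity of the classical solution below `T` (continuity on compact
centred cylinders), and the transfer of the singular vertex to `w`.  Reading for the crux portrait: at a LOUD
survivor the `L³` mass `≥ γν` sits INSIDE the parabola `|x − x₀| ≤ 2√(ν(T−t)/S)` at ALL late times, with a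
UNIVERSAL `γ`, while `‖u(T)‖_{L³(B(x₀,r))} → 0` — so `u(t) ↛ u(T)` in `L³_loc` although `u(t) → u(T)` in
`L²_loc` (`tendsto_localEnergy_sub_top`).  WHAT THIS IS NOT: not 18385, not a Type-I exclusion, NOT NS regularity.
-/

noncomputable section

open MeasureTheory Set Function Metric Filter Topology Literature.Analysis.FluidPDE
open scoped ENNReal NNReal

namespace Summit.NavierStokesRegularity.NavierStokesRegularity.Theorems.TypeITraceScarL3

/-- **The Barker–Prange `L³` floor in the similarity parabola, for the item's binders.**  There is a
universal `γ > 0` such that: for `(u,p)` classical on `[0,T)` with viscosity `ν > 0`, Leray–Hopf on `[0,T]`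
and Type I in time at `T`, and every backward-singular vertex `(T,x₀)` (item form), there are
`S ∈ (0, 1/4]` and `t⋆ < T` with `‖u(t)‖_{L³(B̄(x₀, 2√(ν(T−t)/S)))} > γν` for every `t ∈ (t⋆, T)`.
[cite: BarkerPrange2020, Thm. 2; Leray1934, §31; AlbrittonBarker2019, Lemma 2.5] -/
theorem typeI_singular_L3ParabolicFloor :
    ∃ γ : ℝ, 0 < γ ∧ ∀ (ν T : ℝ), 0 < ν → 0 < T →
      ∀ (u : ℝ → EuclideanSpace ℝ (Fin 3) → EuclideanSpace ℝ (Fin 3))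
        (p : ℝ → EuclideanSpace ℝ (Fin 3) → ℝ),
      IsClassicalNSSolutionOn (Set.Ico 0 T) ν 0 u p → IsLerayHopfOn T ν 0 (u 0) u → IsTypeIBlowup u T →
      ∀ x₀ : EuclideanSpace ℝ (Fin 3),
      (∀ r : ℝ, 0 < r →
        eLpNorm (uncurry u) ⊤ (volume.restrict (parabolicCylinder r (T, x₀))) = ⊤) →
      ∃ S tStar : ℝ, 0 < S ∧ S ≤ 1 / 4 ∧ tStar < T ∧ ∀ t ∈ Ioo tStar T,
        ENNReal.ofReal (γ * ν) <
          eLpNorm (u t) 3 (volume.restrict (closedBall x₀ (2 * Real.sqrt (ν * (T - t) / S)))) := by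
  obtain ⟨γ, hγ, hBP⟩ := BarkerPrange2020_thm2_holds
  refine ⟨γ, hγ, fun ν T hν hT u p hcl hLH hTI x₀ hsing => ?_⟩
  -- ### the Type-I Morrey bound, about every centre, turned into BP's `L²(B(y,r)) ≤ M ν √r`
  obtain ⟨rM, M₀, TM, hrM, hTM, hmorB⟩ := morrey_of_typeI hν hT hcl hLH hTI
  set M₁ : ℝ := max M₀ 0 with hM₁
  have hM₁0 : 0 ≤ M₁ := le_max_right _ _
  set M : ℝ := Real.sqrt M₁ / ν + 1 with hM_def
  have hMpos : 0 < M := by positivity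
  obtain ⟨S, hS, hS4, hBP'⟩ := hBP M hMpos
  -- the scale `r₁`: `r₁ ≤ rM` and `T − r₁²/ν ≥ max TM 0`
  set TM' : ℝ := max TM (T / 2) with hTM'
  have hTM'T : TM' < T := max_lt hTM (by linarith)
  have hTM'0 : 0 < TM' := lt_of_lt_of_le (by linarith) (le_max_right _ _)
  set r₁ : ℝ := min rM (Real.sqrt (ν * (T - TM'))) with hr₁
  have hr₁pos : 0 < r₁ := lt_min hrM (Real.sqrt_pos.2 (mul_pos hν (sub_pos.2 hTM'T)))
  have hr₁M : r₁ ≤ rM := min_le_left _ _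
  have hr₁T : r₁ ^ 2 ≤ ν * (T - TM') := by
    have h1 : r₁ ≤ Real.sqrt (ν * (T - TM')) := min_le_right _ _
    calc r₁ ^ 2 ≤ (Real.sqrt (ν * (T - TM'))) ^ 2 := pow_le_pow_left₀ hr₁pos.le h1 2
      _ = ν * (T - TM') := Real.sq_sqrt (by positivity)
  -- ### Leray continuation past `T`
  obtain ⟨w, hwG, hwu⟩ := hLH.exists_isGlobalLerayHopf_extension_le hν hT
  -- ### BP hypotheses for `w`
  have hmorW : ∀ (y : EuclideanSpace ℝ (Fin 3)) (r : ℝ), 0 < r → ENNReal.ofReal r < ENNReal.ofReal r₁ →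
      ∀ t : ℝ, 0 < t → T - r ^ 2 / ν < t → t < T →
        eLpNorm (w t) 2 (volume.restrict (ball y r)) ≤ ENNReal.ofReal (M * ν * Real.sqrt r) := by
    intro y r hr hrr t _ht0 htl htT
    have hrr' : r < r₁ := (ENNReal.ofReal_lt_ofReal_iff hr₁pos).1 hrr
    have hrM' : r ≤ rM := hrr'.le.trans hr₁M
    -- `t ∈ (TM, T)`: `T − r²/ν ≥ T − r₁²/ν ≥ TM'`
    have htTM : TM' < t := by
      have h1 : r ^ 2 ≤ r₁ ^ 2 := pow_le_pow_left₀ hr.le hrr'.le 2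
      have h2 : r ^ 2 / ν ≤ T - TM' := by
        rw [div_le_iff₀ hν]; nlinarith
      linarith
    have ht' : t ∈ Ioo TM T := ⟨(le_max_left _ _).trans_lt htTM, htT⟩
    have htIcc : t ∈ Icc 0 T := ⟨(hTM'0.trans htTM).le, htT.le⟩
    rw [hwu t htT.le]
    have hreal := hmorB t ht' y r hr hrM'
    have hmem : MemLp (u t) 2 volume := hLH.memLp t htIcc
    -- `‖u t‖_{L²(B)} = (∫_B |u t|²)^{1/2} ≤ √(M₁ r) ≤ M ν √r`
    have h1 : eLpNorm (u t) 2 (volume.restrict (ball y r)) =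
        (∫⁻ x in ball y r, ‖u t x‖ₑ ^ 2) ^ (1 / 2 : ℝ) := by
      have hsq : eLpNorm (u t) 2 (volume.restrict (ball y r)) ^ 2 = ∫⁻ x in ball y r, ‖u t x‖ₑ ^ 2 := by
        rw [eLpNorm_eq_lintegral_rpow_enorm_toReal two_ne_zero ENNReal.ofNat_ne_top,
          ENNReal.toReal_ofNat, ENNReal.rpow_half_sq]
        simp_rw [ENNReal.rpow_two]
      rw [← hsq, ← ENNReal.rpow_natCast, ← ENNReal.rpow_mul]
      norm_num
    rw [h1, lintegral_ball_enorm_sq_eq_ofReal hmem y r]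
    have h2 : ∫ x in ball y r, ‖u t x‖ ^ 2 ≤ M₁ * r :=
      hreal.trans (mul_le_mul_of_nonneg_right (le_max_left _ _) hr.le)
    calc (ENNReal.ofReal (∫ x in ball y r, ‖u t x‖ ^ 2)) ^ (1 / 2 : ℝ)
        ≤ (ENNReal.ofReal (M₁ * r)) ^ (1 / 2 : ℝ) := by gcongr
      _ = ENNReal.ofReal (Real.sqrt (M₁ * r)) := by
          rw [Real.sqrt_eq_rpow, ENNReal.ofReal_rpow_of_nonneg (by positivity) (by norm_num)]
      _ ≤ ENNReal.ofReal (M * ν * Real.sqrt r) := by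
          refine ENNReal.ofReal_le_ofReal ?_
          rw [Real.sqrt_mul hM₁0]
          have hsr : 0 ≤ Real.sqrt r := Real.sqrt_nonneg _
          have hMν : Real.sqrt M₁ ≤ M * ν := by
            rw [hM_def, add_mul, div_mul_cancel₀ _ hν.ne']; linarith
          exact mul_le_mul_of_nonneg_right hMν hsr
  have hregW : ∀ t ∈ Ioo 0 T, ∀ x : EuclideanSpace ℝ (Fin 3), IsRegularPoint w (t, x) := by
    intro t ht x
    -- a centred cylinder `Q*_r(t,x)` with closure inside `(0,T) × ℝ³`
    set r : ℝ := Real.sqrt (min t (T - t) / 2) with hr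
    have hmin : 0 < min t (T - t) / 2 := by
      have := lt_min ht.1 (sub_pos.2 ht.2); positivity
    have hrpos : 0 < r := Real.sqrt_pos.2 hmin
    have hr2 : r ^ 2 = min t (T - t) / 2 := Real.sq_sqrt hmin.le
    have hlo : 0 < t - r ^ 2 := by
      rw [hr2]; have := min_le_left t (T - t); linarith [ht.1]
    have hhi : t + r ^ 2 < T := by
      rw [hr2]; have := min_le_right t (T - t); linarith
    refine ⟨r, hrpos, ?_⟩
    -- `w = u` on the cylinder, and `u` is continuous on the compact closure
    have hK : IsCompact (Icc (t - r ^ 2) (t + r ^ 2) ×ˢ closedBall x r) :=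
      isCompact_Icc.prod (isCompact_closedBall x r)
    have hKsub : Icc (t - r ^ 2) (t + r ^ 2) ×ˢ closedBall x r ⊆
        Ico 0 T ×ˢ (univ : Set (EuclideanSpace ℝ (Fin 3))) :=
      prod_mono (fun s hs => ⟨hlo.le.trans hs.1, lt_of_le_of_lt hs.2 hhi⟩) (subset_univ _)
    have hcont : ContinuousOn (uncurry u) (Icc (t - r ^ 2) (t + r ^ 2) ×ˢ closedBall x r) :=
      hcl.smooth_velocity.continuousOn.mono hKsub
    obtain ⟨Kb, hKb⟩ := hK.exists_bound_of_continuousOn hcont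
    have hcyl : parabolicCylinderCentered r ((t, x) : ℝ × EuclideanSpace ℝ (Fin 3)) ⊆
        Icc (t - r ^ 2) (t + r ^ 2) ×ˢ closedBall x r := by
      rintro ⟨s, z⟩ hsz
      rw [mem_parabolicCylinderCentered] at hsz
      exact ⟨⟨hsz.1.1.le, hsz.1.2.le⟩, mem_closedBall.2 (le_of_lt hsz.2)⟩
    have hbound : ∀ᵐ q ∂(volume.restrict
        (parabolicCylinderCentered r ((t, x) : ℝ × EuclideanSpace ℝ (Fin 3)))), ‖uncurry w q‖ ≤ Kb := by
      refine (ae_restrict_mem (isOpen_parabolicCylinderCentered r _).measurableSet).mono ?_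
      rintro ⟨s, z⟩ hsz
      have hsT : s ≤ T := by
        rw [mem_parabolicCylinderCentered] at hsz
        exact (hsz.1.2.trans hhi).le
      have : uncurry w (s, z) = uncurry u (s, z) := by
        simp only [uncurry_apply_pair, hwu s hsT]
      rw [this]
      exact hKb _ (hcyl hsz)
    calc eLpNorm (uncurry w) ⊤ (volume.restrict
          (parabolicCylinderCentered r ((t, x) : ℝ × EuclideanSpace ℝ (Fin 3))))
        ≤ ENNReal.ofReal Kb := by
          rw [eLpNorm_exponent_top]; exact eLpNormEssSup_le_of_ae_bound hbound
      _ < ⊤ := ENNReal.ofReal_lt_top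
  have hsingW : ∀ r : ℝ, 0 < r → r ^ 2 < T →
      eLpNorm (uncurry w) ⊤ (volume.restrict (parabolicCylinder r ((T, x₀) : ℝ × EuclideanSpace ℝ (Fin 3)))) = ⊤ := by
    intro r hr _
    have hae : (uncurry w) =ᵐ[volume.restrict (parabolicCylinder r ((T, x₀) : ℝ × EuclideanSpace ℝ (Fin 3)))]
        uncurry u := by
      refine (ae_restrict_mem (isOpen_parabolicCylinder r _).measurableSet).mono ?_
      rintro ⟨s, z⟩ hsz
      rw [mem_parabolicCylinder] at hsz
      simp only [uncurry_apply_pair, hwu s (le_of_lt hsz.1.2)]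
    rw [eLpNorm_congr_ae hae]
    exact hsing r hr
  -- ### Barker–Prange for `w`, read back on `u`
  obtain ⟨tStar, _, htT, -, hBPw⟩ := hBP' ν T hν hT (ENNReal.ofReal r₁) (ENNReal.ofReal_pos.2 hr₁pos)
  refine ⟨S, tStar, hS, hS4, htT, fun t ht => ?_⟩
  have key := hBPw (u 0) w hwG hmorW hregW x₀ hsingW t ht
  rwa [hwu t ht.2.le] at key

end Summit.NavierStokesRegularity.NavierStokesRegularity.Theorems.TypeITraceScarL3

end
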